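import Summits.Langlands.Langlands.Theses.ExteriorSquareAscent
import Summits.Langlands.Langlands.Theorems.IrreducibilityBySelfDualityIrreducibleOffSectorOfReciprocity
import Summits.Langlands.Langlands.Theorems.AbelianSurfaceSerreSerreGSp4SurjectiveStubAutomorphyLifting
import Summits.Langlands.Langlands.Theorems.RamifiedCoefficientSeedSectorComplementJunctionOfR
import Literature.NumberTheory.Automorphic.ChebotarevArtinRepHolds
import Literature.NumberTheory.Automorphic.AlgebraicityTwist
import Literature.NumberTheory.Automorphic.AutomorphicTwistNorm
import Literature.NumberTheory.GaloisRepresentations.FramedRepEquivConj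
import HarnessLib

/-!
# `ExteriorSquareAscent.RestOfReciprocity` is the summit modulo its own antecedent, and is sandwiched by the item
# `ReciprocityUpToIrreducibilityR` (stmt-Langlands-17925) granted Arthur–Clozel (2.2)–(2.3) — item-level certificate
(crux stmt-Langlands-18056, line `birth` rev 2, lead prover-line-stmt-Langlands-18056-0; `--supports` file: no `sorry`, no
definition, axioms `propext` / `Classical.choice` / `Quot.sound`; imports the route module, landed Theorems modules and Literature)

`RestOfReciprocity := IrreducibleGL4 → _root_.Langlands` is the D-0027 frame item of route `ExteriorSquareAscent` ("the rest of
the mountain": everything the route's target `X = IrreducibleGL4` — irreducibility of semisimple `ℓ`-adic avatars of cuspidal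
C-algebraic `π` on `GL₄` with a Hecke field, not essentially self-dual at Satake level, C-normalisation `arithFrobPolyOfSatake ι q 4`
— does not claim).  This file records, as kernel facts on the texts of EXISTING items, what the crux is:

* `irreducibleGL4_of_langlands` — **`Langlands → IrreducibleGL4`** (tightness of the frame; the content of the crux-attack refuter's
  evidence `LanglandsImpliesX.lean`, 2026-08-17, landed here): clause (A) of the summit for the L-algebraic twist
  `π' = π ⊗ ‖det‖_𝔸^{-3/2}` (Borel–Jacquet 5.7; Buzzard–Gee §5.3: `T` C-algebraic ⇒ `T.twist (3/2)` L-algebraic ⇒ so is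
  `T.twist (-3/2) = (T.twist (3/2)).twist (-3)`), whose Satake parameters are `q_v^{3/2} · α` (`HasSatakeParamAt.of_map_mulChar_detTwist_of_cpow`),
  and `arithFrobPolyOfSatake ι q 1 (q^{3/2} α) = arithFrobPolyOfSatake ι q 4 α` (landed `SingerTypeEvaporation.arithFrobPolyOfSatake_one_twist`: the
  C-normalisation IS the summit's L-normalisation on the twist — no normalisation slip); then the irreducible avatar `ρ₀` of (A)
  transfers irreducibility to every a.e.-compatible `ρ` (Chebotarev + Brauer–Nesbitt, landed
  `IrreducibleOffSector.isIrreducible_of_satakeFrobCompatible`).  X's Hecke-field, non-self-duality and semisimplicity hypotheses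
  are not used;
* `langlands_iff_irreducibleGL4_and_restOfReciprocity` — `Langlands ↔ IrreducibleGL4 ∧ RestOfReciprocity`, and
  `not_restOfReciprocity_iff` — `¬ RestOfReciprocity ↔ IrreducibleGL4 ∧ ¬ Langlands`: refuting the crux = proving X and refuting the
  audited summit; proving the crux = proving the summit given X;
* (imported, not restated — gate dedup) `RamifiedCoefficientSeedJunctionOfR.langlands_of_reciprocityUpToIrreducibilityR_text_of_JS`
  — JS (2.2) → JS (2.3) → R → `Langlands`, with R := the text of item stmt-Langlands-17925
  `IrreducibilityBySelfDuality.ReciprocityUpToIrreducibilityR` (reciprocity up to irreducibility for EVERY pinned reciprocity datum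
  + the non-vacuity conjunct; written out verbatim because the decl lives in another route's Theses module) and JS := the Literature
  named facts `JacquetShalika1981_partialPairL_boundary_repData` / `…_pole_repData` (= items stmt-Langlands-13622
  `AnalyticDescent.PairLBoundaryJS` / stmt-Langlands-19093 `AnalyticDescent.PairLPoleJS` by `Iff.rfl`): clause (B) is R's; clause
  (A)'s avatar — and every a.e.-compatible `ρ'` — is irreducible by the landed isobaric bootstrap
  `IrreducibleOffSector.isIrreducible_of_reciprocityUpToIrreducibility` (p103935), and uniqueness up to conjugacy is Chebotarev +
  Brauer–Nesbitt; landed by the lead of the sibling frame stmt-Langlands-16781 (`Theorems/RamifiedCoefficientSeedSectorComplementJunctionOfR.lean`),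
  itself a re-elaboration of the seam `SectorComplementSeam.langlands_of_reciprocityUpToIrreducibility_forall_text_of_JS` (p147356);
  likewise `…JunctionOfR.reciprocityUpToIrreducibilityR_text_of_langlands` (R is a weakening of the summit);
* `restOfReciprocity_of_reciprocityUpToIrreducibilityR_text_of_JS` — SUFFICIENCY: JS ∧ R ⇒ the crux, `X` DISCARDED (X is inert:
  irreducibility in clause (A) is free given (A') + (B) + JS);
* `restOfReciprocity_of_langlands` — the crux is a weakening of the summit;
* `reciprocityUpToIrreducibilityR_text_of_restOfReciprocity` — NECESSITY under the target: X ∧ crux ⇒ `Langlands` ⇒ R;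
* `restOfReciprocity_iff_irreducibleGL4_imp_reciprocityUpToIrreducibilityR_text` — under JS, **`RestOfReciprocity ↔ (IrreducibleGL4 → R)`**;
  `restOfReciprocity_iff_reciprocityUpToIrreducibilityR_text` — under JS and X, crux ↔ R.

So the crux's open content is exactly item stmt-Langlands-17925 (plus the two Jacquet–Shalika formalisation debts): the lead's
outcome `blocked-on: stmt-Langlands-17925`.

References: K. Buzzard, T. Gee, LMS LNS 414 (2014), §3.1, §5.3, Conj. 3.2.1–3.2.2 [BuzzardGeeLMS2014]; J.-M. Fontaine, B. Mazur
(1995), Conj. 1 [FontaineMazurGeometric1995]; A. Borel, H. Jacquet, Corvallis 1979, 5.7 [BorelJacquet1979]; J. Arthur, L. Clozel,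
Ann. Math. Stud. 120, Ch. 3 §2 (2.2)–(2.3) [ArthurClozelAMS120]; F. Calegari, T. Gee, Ann. Inst. Fourier 63 (2013) §1.1
[CalegariGee2013]; P. Deligne, J.-P. Serre, ASENS 7 (1974), Lemme 3.2 [DeligneSerreASENS1974]; M. Harris, K.-W. Lan, R. Taylor,
J. Thorne, Res. Math. Sci. 3 (2016), Thm. A [HarrisLanTaylorThorneRMS2016].
-/

noncomputable section

set_option linter.dupNamespace false -- project-wide option; `Summit.Langlands.Langlands` is the mandated namespace

open scoped NumberField Classical Polynomial
open Filter IsDedekindDomain Polynomial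
open Literature.NumberTheory.Automorphic Literature.NumberTheory.GaloisRepresentations
open Summit.Langlands
open Summit.Langlands.Langlands.Theses.ExteriorSquareAscent (RestOfReciprocity IrreducibleGL4)
open Summit.Langlands.Langlands.Theorems.IrreducibleOffSector

namespace Summit.Langlands.Langlands.Theorems.RestOfReciprocityOfR

/-! ## 1. Tightness of the frame: `Langlands → IrreducibleGL4`

X's C-normalisation is the summit's L-normalisation on the twist `π ⊗ ‖det‖^{-3/2}`: the Frobenius polynomial predicted in
Buzzard–Gee's L-normalisation (`m = 1`) by the Satake parameter `q^{3/2} · α` of `π ⊗ ‖det‖_𝔸^{-3/2}` is the one predicted in the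
Harris–Lan–Taylor–Thorne normalisation (`m = 4`) by the Satake parameter `α` of `π` — the landed lemma
`SerreGSp4Surjective.SingerTypeEvaporation.arithFrobPolyOfSatake_one_twist` (reused, not restated). -/

/-- **`Langlands → IrreducibleGL4`** (tightness of the frame item: the crux `RestOfReciprocity := IrreducibleGL4 → Langlands`
can fail only together with the audited summit).  Given the summit and the data of X — `π` cuspidal C-algebraic on `GL₄(𝔸_K)`
and `ρ : Γ_K → GL₄(ℚ̄_ℓ)` with `charpoly ρ(Frob_v) = arithFrobPolyOfSatake ι q_v 4 (t_{π,v})` at almost all `v` — pass to the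
L-algebraic cuspidal twist `π' = π ⊗ ‖det‖_𝔸^{-3/2}` (Borel–Jacquet 5.7; Buzzard–Gee §5.3), whose Satake parameters are
`q_v^{3/2} t_{π,v}`, so that `ρ` is Satake–Frobenius compatible with `π'` a.e. in the summit's L-normalisation
(`SingerTypeEvaporation.arithFrobPolyOfSatake_one_twist`, landed); clause (A) of the summit (any reciprocity datum, which exists by the non-vacuity
conjunct) gives an IRREDUCIBLE avatar `ρ₀` of `π'`, and irreducibility transfers to `ρ` by Chebotarev + Brauer–Nesbitt
(`IrreducibleOffSector.isIrreducible_of_satakeFrobCompatible`).  X's Hecke-field, non-essential-self-duality and semisimplicity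
hypotheses are idle. [cite: BuzzardGeeLMS2014, Conj. 3.2.1 and §5.3] [cite: DeligneSerreASENS1974, Lemme 3.2] -/
theorem irreducibleGL4_of_langlands (hLang : _root_.Langlands) : IrreducibleGL4 := by
  intro K _ _ _h1 hcpt π hC _hE _hNE ℓ _ ι ρ _hss hcomp
  -- a reciprocity datum (non-vacuity conjunct) and clause (A) of the summit in rank 4
  obtain ⟨⟨𝓡⟩, hGLC⟩ := hLang K
  obtain ⟨hA, -⟩ := hGLC 𝓡 4 (by norm_num) hcpt
  -- the L-algebraic cuspidal twist `π' = π ⊗ ‖det‖^{-3/2}`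
  obtain ⟨T, hT, hTC⟩ := hC
  obtain ⟨χ, π', hχ, hW, hW', hT'⟩ := π.exists_twist_hasInfinityType (-(3 / 2 : ℝ)) hT
  have hL' : π'.1.IsLAlgebraic := by
    refine ⟨_, hT', ?_⟩
    have h3 : (T.twist ((((4 : ℕ) : ℂ) - 1) / 2)).IsLAlgebraic :=
      (InfinityType.isCAlgebraic_iff_isLAlgebraic_twist T).mp hTC
    have h0 := h3.twist_intCast (-3)
    rw [InfinityType.twist_twist] at h0
    convert h0 using 2
    push_cast
    norm_num
  obtain ⟨ρ₀, hirr₀, -, hcorr₀, -⟩ := hA π' hL' ℓ ι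
  -- `ρ` is Satake–Frobenius compatible with `π'` a.e., in the L-normalisation of the summit
  have hρ : ∀ᶠ v : HeightOneSpectrum (𝓞 K) in cofinite, SatakeFrobCompatibleAt ι π'.1 ρ v := by
    filter_upwards [hcomp] with v hv
    obtain ⟨α, hα, hur, hcp⟩ := hv
    refine ⟨α.map (((v.residueCard : ℂ) ^ (-(((-(3 / 2 : ℝ)) : ℝ) : ℂ))) * ·), ?_, hur, ?_⟩
    · exact AutomorphicRepData.HasSatakeParamAt.of_map_mulChar_detTwist_of_cpow hχ hW hW' hα
    · rw [Summit.Langlands.Langlands.Cruxes.SerreGSp4Surjective.SingerTypeEvaporation.arithFrobPolyOfSatake_one_twist]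
      exact hcp
  exact isIrreducible_of_satakeFrobCompatible π'.1 ι hirr₀ hcorr₀.1 hρ

/-- **The summit gives the crux outright** (discard the antecedent). [folklore] -/
theorem restOfReciprocity_of_langlands (hLang : _root_.Langlands) : RestOfReciprocity :=
  fun _ => hLang

/-- **`Langlands ↔ IrreducibleGL4 ∧ RestOfReciprocity`**: the frame item is EXACTLY the summit modulo the route's target.
[cite: BuzzardGeeLMS2014, Conj. 3.2.1 and Conj. 3.2.2] -/
theorem langlands_iff_irreducibleGL4_and_restOfReciprocity : _root_.Langlands ↔ Summit.Langlands.Langlands.Theses.ExteriorSquareAscent.IrreducibleGL4 ∧ Summit.Langlands.Langlands.Theses.ExteriorSquareAscent.RestOfReciprocity :=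
  ⟨fun h => ⟨irreducibleGL4_of_langlands h, restOfReciprocity_of_langlands h⟩, fun h => h.2 h.1⟩

/-- **`¬ RestOfReciprocity ↔ IrreducibleGL4 ∧ ¬ Langlands`**: refuting the crux means proving the route target AND refuting the
audited summit. [folklore] -/
theorem not_restOfReciprocity_iff : ¬ RestOfReciprocity ↔ IrreducibleGL4 ∧ ¬ _root_.Langlands := by
  constructor
  · intro h
    by_contra h'
    exact h fun hX => by_contra fun hL => h' ⟨hX, hL⟩
  · rintro ⟨hX, hL⟩ h
    exact hL (h hX)

/-! ## 2. The crux sandwiched by item stmt-Langlands-17925 under Arthur–Clozel (2.2)–(2.3) -/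

/-- **SUFFICIENCY — the crux from R and JS (2.2)–(2.3), the antecedent `X` DISCARDED**: `RestOfReciprocity` follows from the texts
of items stmt-Langlands-17925, stmt-Langlands-13622, stmt-Langlands-19093.  `X = IrreducibleGL4` is inert: irreducibility in clause
(A) is free given (A') + (B) + JS (isobaric bootstrap), and R asks for no irreducibility that X could supply.
[cite: BuzzardGeeLMS2014, Conj. 3.2.1 and Conj. 3.2.2] [cite: ArthurClozelAMS120, Ch. 3 §2 (2.2)–(2.3)] -/
theorem restOfReciprocity_of_reciprocityUpToIrreducibilityR_text_of_JS
    (h22 : JacquetShalika1981_partialPairL_boundary_repData) (h23 : JacquetShalika1981_partialPairL_pole_repData)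
    (hR : ∀ (F : Type) [Field F] [NumberField F], Nonempty (ReciprocityData F) ∧ ∀ (Rec : ReciprocityData F) (n : ℕ), 0 < n → ∀ hcpt : Literature.NumberTheory.Automorphic.isCompact_glFiniteIntegralLevel n F, (∀ π : Literature.NumberTheory.Automorphic.CuspidalAutomorphicRepData n F hcpt, π.1.IsLAlgebraic → ∀ (ℓ : ℕ) [Fact ℓ.Prime] (ι : PadicAlgCl ℓ ≃+* ℂ), ∃ ρ : Literature.NumberTheory.GaloisRepresentations.FramedGaloisRep F (PadicAlgCl ℓ) n, IsGeometricFramed Rec ρ ∧ Corresponds Rec ι π.1 ρ) ∧ GaloisToAutomorphic n Rec hcpt) :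
    RestOfReciprocity :=
  fun _ => RamifiedCoefficientSeedJunctionOfR.langlands_of_reciprocityUpToIrreducibilityR_text_of_JS h22 h23 hR

/-- **NECESSITY under the route target**: granted `X = IrreducibleGL4` (assembled from cruxes 2–4 inside `closes`), the crux
yields the summit and hence the text of item stmt-Langlands-17925 — the crux cannot close before that item once X holds. [folklore] -/
theorem reciprocityUpToIrreducibilityR_text_of_restOfReciprocity (hX : IrreducibleGL4) (h : RestOfReciprocity) :
    ∀ (F : Type) [Field F] [NumberField F], Nonempty (ReciprocityData F) ∧ ∀ (Rec : ReciprocityData F) (n : ℕ), 0 < n → ∀ hcpt : Literature.NumberTheory.Automorphic.isCompact_glFiniteIntegralLevel n F, (∀ π : Literature.NumberTheory.Automorphic.CuspidalAutomorphicRepData n F hcpt, π.1.IsLAlgebraic → ∀ (ℓ : ℕ) [Fact ℓ.Prime] (ι : PadicAlgCl ℓ ≃+* ℂ), ∃ ρ : Literature.NumberTheory.GaloisRepresentations.FramedGaloisRep F (PadicAlgCl ℓ) n, IsGeometricFramed Rec ρ ∧ Corresponds Rec ι π.1 ρ) ∧ GaloisToAutomorphic n Rec hcpt :=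
  RamifiedCoefficientSeedJunctionOfR.reciprocityUpToIrreducibilityR_text_of_langlands (h hX)

/-- **Under JS (2.2)–(2.3), `RestOfReciprocity ↔ (IrreducibleGL4 → R)`**: the crux IS "X implies reciprocity up to
irreducibility for every pinned datum" — and since R asks for no irreducibility, X is inert in it.
[cite: BuzzardGeeLMS2014, Conj. 3.2.1 and Conj. 3.2.2] [cite: ArthurClozelAMS120, Ch. 3 §2 (2.2)–(2.3)] -/
theorem restOfReciprocity_iff_irreducibleGL4_imp_reciprocityUpToIrreducibilityR_text
    (h22 : JacquetShalika1981_partialPairL_boundary_repData) (h23 : JacquetShalika1981_partialPairL_pole_repData) :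
    RestOfReciprocity ↔ (IrreducibleGL4 →
      ∀ (F : Type) [Field F] [NumberField F], Nonempty (ReciprocityData F) ∧ ∀ (Rec : ReciprocityData F) (n : ℕ), 0 < n → ∀ hcpt : Literature.NumberTheory.Automorphic.isCompact_glFiniteIntegralLevel n F, (∀ π : Literature.NumberTheory.Automorphic.CuspidalAutomorphicRepData n F hcpt, π.1.IsLAlgebraic → ∀ (ℓ : ℕ) [Fact ℓ.Prime] (ι : PadicAlgCl ℓ ≃+* ℂ), ∃ ρ : Literature.NumberTheory.GaloisRepresentations.FramedGaloisRep F (PadicAlgCl ℓ) n, IsGeometricFramed Rec ρ ∧ Corresponds Rec ι π.1 ρ) ∧ GaloisToAutomorphic n Rec hcpt) :=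
  ⟨fun h hX => reciprocityUpToIrreducibilityR_text_of_restOfReciprocity hX h,
    fun h hX => RamifiedCoefficientSeedJunctionOfR.langlands_of_reciprocityUpToIrreducibilityR_text_of_JS h22 h23 (h hX)⟩

/-- **Under JS (2.2)–(2.3) and the route target, the crux is EQUIVALENT to the text of item stmt-Langlands-17925** (sufficiency +
necessity): the frame's open content is exactly reciprocity up to irreducibility for every pinned reciprocity datum.
[cite: BuzzardGeeLMS2014, Conj. 3.2.1 and Conj. 3.2.2] [cite: ArthurClozelAMS120, Ch. 3 §2 (2.2)–(2.3)] -/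
theorem restOfReciprocity_iff_reciprocityUpToIrreducibilityR_text
    (h22 : JacquetShalika1981_partialPairL_boundary_repData) (h23 : JacquetShalika1981_partialPairL_pole_repData)
    (hX : IrreducibleGL4) :
    RestOfReciprocity ↔
      ∀ (F : Type) [Field F] [NumberField F], Nonempty (ReciprocityData F) ∧ ∀ (Rec : ReciprocityData F) (n : ℕ), 0 < n → ∀ hcpt : Literature.NumberTheory.Automorphic.isCompact_glFiniteIntegralLevel n F, (∀ π : Literature.NumberTheory.Automorphic.CuspidalAutomorphicRepData n F hcpt, π.1.IsLAlgebraic → ∀ (ℓ : ℕ) [Fact ℓ.Prime] (ι : PadicAlgCl ℓ ≃+* ℂ), ∃ ρ : Literature.NumberTheory.GaloisRepresentations.FramedGaloisRep F (PadicAlgCl ℓ) n, IsGeometricFramed Rec ρ ∧ Corresponds Rec ι π.1 ρ) ∧ GaloisToAutomorphic n Rec hcpt :=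
  ⟨reciprocityUpToIrreducibilityR_text_of_restOfReciprocity hX,
    restOfReciprocity_of_reciprocityUpToIrreducibilityR_text_of_JS h22 h23⟩

/-- **Registered certificate (closed form, one line):** under Arthur–Clozel (2.2)–(2.3), `RestOfReciprocity ↔ (IrreducibleGL4 → R)`
with R the text of item stmt-Langlands-17925 — the registered signature `restOfReciprocity_iff_of_JS` of crux stmt-Langlands-18056.
[cite: BuzzardGeeLMS2014, Conj. 3.2.1 and Conj. 3.2.2] [cite: ArthurClozelAMS120, Ch. 3 §2 (2.2)–(2.3)] -/
theorem restOfReciprocity_iff_of_JS : Literature.NumberTheory.Automorphic.JacquetShalika1981_partialPairL_boundary_repData → Literature.NumberTheory.Automorphic.JacquetShalika1981_partialPairL_pole_repData → (Summit.Langlands.Langlands.Theses.ExteriorSquareAscent.RestOfReciprocity ↔ (Summit.Langlands.Langlands.Theses.ExteriorSquareAscent.IrreducibleGL4 → ∀ (F : Type) [Field F] [NumberField F], Nonempty (ReciprocityData F) ∧ ∀ (Rec : ReciprocityData F) (n : ℕ), 0 < n → ∀ hcpt : Literature.NumberTheory.Automorphic.isCompact_glFiniteIntegralLevel n F, (∀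 π : Literature.NumberTheory.Automorphic.CuspidalAutomorphicRepData n F hcpt, π.1.IsLAlgebraic → ∀ (ℓ : ℕ) [Fact ℓ.Prime] (ι : PadicAlgCl ℓ ≃+* ℂ), ∃ ρ : Literature.NumberTheory.GaloisRepresentations.FramedGaloisRep F (PadicAlgCl ℓ) n, IsGeometricFramed Rec ρ ∧ Corresponds Rec ι π.1 ρ) ∧ GaloisToAutomorphic n Rec hcpt)) :=
  fun h22 h23 => restOfReciprocity_iff_irreducibleGL4_imp_reciprocityUpToIrreducibilityR_text h22 h23

end Summit.Langlands.Langlands.Theorems.RestOfReciprocityOfR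

end
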